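import Literature.MathematicalPhysics.KineticTheory.EvenStatTruncationBound
import Literature.Analysis.FluidPDE.HardSphereRegularGeometry
import Summits.AtomisticToContinuum.HydrodynamicLimit.Theorems.JParityClosureEmpiricalEnskogIdentity
import Summits.AtomisticToContinuum.HydrodynamicLimit.Theorems.DensityCap.Negative.KernelMass
import Summits.AtomisticToContinuum.HydrodynamicLimit.Theorems.JParityClosureAssemblyMomentumModulus

/-!
# Route JParityClosure — `Assembly` (stmt-AtomisticToContinuum-17595): the windowed speed-jump
# statistic is dominated by the `EvenStressEnskog` collision sums (pathwise part)

The momentum input `hequi_momentum_localGibbs` of the fixed-time upgrade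
(`JParityClosureAssemblyMomentumModulus.lean`) is conditional on ONE windowed hypothesis `hstat`: small
windows carry small normalised speed-jump statistic `(ε_N/(N+1))·½𝒮(t, t+Δ]`,
`𝒮 = collisionalTransferFunctional` with kernel `|vᵢ⁺ − vᵢ⁻|`. This file and its companion
(`…SpeedJumpWindowOfEvenStat.lean`) derive `hstat` from the route's crux `EvenStressEnskog` (read through
its `Iff.rfl` vocabulary `collisionSum` / `evenStat` / `enskogRate` of `EvenCollisionTubeFunctional.lean`)
together with the no-overcompression cap (`DensityCap`, vocabulary `DensityCapNegative.CapLimit`), the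
packing guard and the energy tightness of the conjunct. Pathwise facts proved here:

* `sum_evenMark_diag` — at a unit normal the trace of the even marks is the normal approach speed,
  `Σ_k Ξ_P^{kk}(n̂, v, w) = ((w − v)·n̂)₊`;
* `norm_vel_sub_leftLim_eq` — at a collision of a hard-sphere trajectory the speed jump of a partner IS
  that trace read at the pre-collisional pair recovered by `reflectVel`: `|vᵢ⁺ − vᵢ⁻| = ((vⱼ⁻ − vᵢ⁻)·n̂ᵢⱼ)₊`;
* `speedJump_window_le_sum_collisionSum` — along a good orbit, for weights `χ ≥ 0` that are `≥ 1` on the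
  window and a cutoff `g ≥ 0` that equals `1` at the (capped) mollified densities of the colliding
  particles, `ε_N (N+1)⁻¹ 𝒮(t₁, t₂] ≤ Σ_k collisionSum σ N Φ τ χ g Ξ_P^{kk} r` (`0 ≤ t₁`, `t₂ ≤ τ`);
* `pairFunctional_evenMark_diag_le` — the Enskog-side pair functional of `Ξ_P^{kk}` is at most
  `4|S²| · ρ_r(x₀) · e_r(x₀)`, `e_r` the cone-mollified kinetic energy density (whose Haar integral is
  twice the kinetic energy per particle, `integral_coneEnergy`).

No new objects (all functionals are the tree's; the cone-mollified energy is written inline).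
-/

noncomputable section

namespace Summit.AtomisticToContinuum.HydrodynamicLimit.Theorems.JParityClosureSpeedJumpWindow

open Set MeasureTheory Filter Topology Function
open scoped ENNReal InnerProductSpace
open Literature.Analysis.FluidPDE Literature.Analysis.FunctionSpaces
open Literature.MathematicalPhysics.KineticTheory
open Summit.AtomisticToContinuum.HydrodynamicLimit.Theorems.JParityClosureMomentumModulus

/-! ### The trace of the even marks is the normal approach speed -/

/-- `Σ_k n_k² = 1` for a unit vector of `ℝ³`. [folklore] -/
theorem sum_mul_self_eq_one {n : V3} (hn : ‖n‖ = 1) : ∑ k, n k * n k = 1 := by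
  have h := EuclideanSpace.real_norm_sq_eq n
  rw [hn, one_pow] at h
  rw [h]
  exact Finset.sum_congr rfl fun k _ => by ring

/-- **Trace of the even marks**: at a unit normal `n`, `Σ_k Ξ_P^{kk}(n, v, w) = ((w − v)·n)₊`. [folklore] -/
theorem sum_evenMark_diag {n : V3} (hn : ‖n‖ = 1) (v w : V3) :
    ∑ k, evenMark k k (n, v, w) = max ⟪w - v, n⟫_ℝ 0 := by
  simp only [evenMark]
  rw [← Finset.mul_sum, sum_mul_self_eq_one hn, mul_one]

/-! ### The speed jump at a collision -/

/-- **The speed jump of a collision partner is the normal approach speed of the pre-collisional pair**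
recovered from the post-collisional one by the reflection law: along a hard-sphere trajectory on `𝕋³`,
at a collision time `t` with `γ t ∈ contactSet i j` (diameter `ε > 0`),
`‖vᵢ(t) − vᵢ(t⁻)‖ = ((w⁻ − v⁻)·ε⁻¹nᵢⱼ)₊` where `(v⁻, w⁻) = reflectVel nᵢⱼ (vᵢ(t), vⱼ(t))` and
`nᵢⱼ = sepVec xᵢ xⱼ`, `‖nᵢⱼ‖ = ε`. [folklore] -/
theorem norm_vel_sub_leftLim_eq {ε : ℝ} (hε : 0 < ε) {N : ℕ} {γ : ℝ → Config N (Fin 3) T3}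
    (h : IsHardSphereTrajectory (Torus.geometry (Fin 3)) ε N γ) {t : ℝ} {i j : Fin N} (hij : i ≠ j)
    (hc : γ t ∈ contactSet (Torus.geometry (Fin 3)) N ε i j) :
    ‖(γ t i).2 - (leftLim γ t i).2‖ =
      max ⟪(reflectVel ((Torus.geometry (Fin 3)).sepVec (γ t i).1 (γ t j).1) ((γ t i).2, (γ t j).2)).2 -
            (reflectVel ((Torus.geometry (Fin 3)).sepVec (γ t i).1 (γ t j).1) ((γ t i).2, (γ t j).2)).1,
          ε⁻¹ • (Torus.geometry (Fin 3)).sepVec (γ t i).1 (γ t j).1⟫_ℝ 0 := by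
  have hG : ∀ x : T3, Continuous ((Torus.geometry (Fin 3)).translate x) := fun x =>
    continuous_const.add Torus.continuous_proj
  have hnε : ‖(Torus.geometry (Fin 3)).sepVec (γ t i).1 (γ t j).1‖ = ε := (mem_contactSet.1 hc).2
  have hpre : reflectVel ((Torus.geometry (Fin 3)).sepVec (γ t i).1 (γ t j).1) ((γ t i).2, (γ t j).2) =
      ((leftLim γ t i).2, (leftLim γ t j).2) := by
    have key := reflectVel_collidePair_vel (G := Torus.geometry (Fin 3)) hij (leftLim γ t)
    rwa [← (h.eq_collidePair_leftLim hij hc).2] at key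
  have hjump := h.vel_sub_leftLim_eq_smul hG hij hc
  have hin : ⟪(Torus.geometry (Fin 3)).sepVec (γ t i).1 (γ t j).1,
      (leftLim γ t i).2 - (leftLim γ t j).2⟫_ℝ < 0 := by
    have hinc : IsIncoming (Torus.geometry (Fin 3)) (leftLim γ t) i j := (h.eq_collidePair_leftLim hij hc).1
    have hpos : ∀ k, (leftLim γ t k).1 = (γ t k).1 := h.leftLim_apply_fst hG t
    simpa only [IsIncoming, hpos] using hinc
  set n : V3 := (Torus.geometry (Fin 3)).sepVec (γ t i).1 (γ t j).1 with hn
  set a : ℝ := ⟪(leftLim γ t i).2 - (leftLim γ t j).2, n⟫_ℝ with ha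
  have ha0 : a < 0 := by rwa [ha, real_inner_comm]
  rw [hpre]
  simp only
  rw [hjump, norm_smul, norm_neg, Real.norm_eq_abs, abs_div, abs_of_nonneg (sq_nonneg ‖n‖), hnε,
    inner_smul_right, ← neg_sub ((leftLim γ t i).2) ((leftLim γ t j).2), inner_neg_left, ← ha,
    abs_of_neg ha0, max_eq_left (by nlinarith [inv_pos.2 hε] : (0 : ℝ) ≤ ε⁻¹ * -a)]
  field_simp

/-- **The contact double sum at a collision time** (torus): the double sum of the route declarations,
`Σᵢ' Σⱼ' [i' ≠ j' ∧ ‖sepVec xᵢ' xⱼ'‖ = ε] F i' j'`, is `F i j + F j i` at a collision time of the pair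
`{i, j}` (a single pair collides; the contact relation is symmetric on `𝕋ᵈ`). [folklore] -/
theorem sum_ite_contact_eq {ε : ℝ} {N : ℕ} {γ : ℝ → Config N (Fin 3) T3}
    (h : IsHardSphereTrajectory (Torus.geometry (Fin 3)) ε N γ) {t : ℝ} {i j : Fin N} (hij : i ≠ j)
    (hc : γ t ∈ contactSet (Torus.geometry (Fin 3)) N ε i j) (F : Fin N → Fin N → ℝ) :
    (∑ i', ∑ j', if i' ≠ j' ∧ ‖(Torus.geometry (Fin 3)).sepVec (γ t i').1 (γ t j').1‖ = ε
        then F i' j' else 0) = F i j + F j i := by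
  have hcji := mem_contactSet_symm_torus hc
  rw [← Fintype.sum_prod_type', Fintype.sum_eq_add (i, j) (j, i)]
  · rw [if_pos ⟨hij, (mem_contactSet.1 hc).2⟩, if_pos ⟨hij.symm, (mem_contactSet.1 hcji).2⟩]
  · exact fun hp => hij (Prod.mk.inj hp).1
  · rintro ⟨i', j'⟩ ⟨hp₁, hp₂⟩
    rw [if_neg]
    rintro ⟨hij', hnorm⟩
    have hc' : γ t ∈ contactSet (Torus.geometry (Fin 3)) N ε i' j' := mem_contactSet.2 ⟨h.mem t, hnorm⟩
    rcases collisionPair_eq_or_eq_of_mem_contactSet h hij hc hij' hc' with ⟨rfl, rfl⟩ | ⟨rfl, rfl⟩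
    · exact hp₁ rfl
    · exact hp₂ rfl

/-- **Per-collision domination.** At a collision time `t` of a hard-sphere trajectory of `N + 1` spheres of
diameter `ε > 0` on `𝕋³`: if the weight satisfies `1 ≤ χ(t, x)` for all `x` and the cutoff `g` equals `1`
at the mollified densities read at the particles, then the speed-jump sum over the colliding pairs is at
most the contact double sum of the marks `χ · g(σ³ρ_r) · Σ_k Ξ_P^{kk}` of the route declaration
`EvenStressEnskog` (in fact equality when `χ(t, ·) = 1`). [folklore] -/
theorem sum_collidingPairs_speedJump_le {ε : ℝ} (hε : 0 < ε) {N : ℕ} {γ : ℝ → Config (N + 1) (Fin 3) T3}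
    (h : IsHardSphereTrajectory (Torus.geometry (Fin 3)) ε (N + 1) γ) {t : ℝ}
    (ht : t ∈ collisionTimes (Torus.geometry (Fin 3)) ε γ) {χ : ℝ × UnitAddTorus (Fin 3) → ℝ}
    (hχ : ∀ x, 1 ≤ χ (t, x)) {g : ℝ → ℝ} {σ r : ℝ}
    (hg : ∀ i, g (σ ^ 3 * mollDensity r (γ t) (γ t i).1) = 1) :
    ∑ p ∈ collidingPairs (Torus.geometry (Fin 3)) ε (γ t), ‖(γ t p.1).2 - (leftLim γ t p.1).2‖ ≤
      ∑ k : Fin 3, ∑ i, ∑ j,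
        (if i ≠ j ∧ ‖(Torus.geometry (Fin 3)).sepVec (γ t i).1 (γ t j).1‖ = ε then
          χ (t, (γ t i).1) * g (σ ^ 3 * mollDensity r (γ t) (γ t i).1) *
            evenMark k k (ε⁻¹ • (Torus.geometry (Fin 3)).sepVec (γ t i).1 (γ t j).1,
              (reflectVel ((Torus.geometry (Fin 3)).sepVec (γ t i).1 (γ t j).1) ((γ t i).2, (γ t j).2)).1,
              (reflectVel ((Torus.geometry (Fin 3)).sepVec (γ t i).1 (γ t j).1) ((γ t i).2, (γ t j).2)).2)
        else 0) := by
  obtain ⟨i, j, hij, hc⟩ := mem_collisionTimes.1 ht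
  have hcji := mem_contactSet_symm_torus hc
  -- unit normals
  have hunit : ∀ {i j : Fin (N + 1)}, γ t ∈ contactSet (Torus.geometry (Fin 3)) (N + 1) ε i j →
      ‖ε⁻¹ • (Torus.geometry (Fin 3)).sepVec (γ t i).1 (γ t j).1‖ = 1 := by
    intro i j hc
    rw [norm_smul, Real.norm_eq_abs, abs_of_pos (inv_pos.2 hε), (mem_contactSet.1 hc).2,
      inv_mul_cancel₀ hε.ne']
  -- the two orientations
  have hone : ∀ {i j : Fin (N + 1)}, i ≠ j → γ t ∈ contactSet (Torus.geometry (Fin 3)) (N + 1) ε i j →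
      ‖(γ t i).2 - (leftLim γ t i).2‖ ≤
        ∑ k : Fin 3, χ (t, (γ t i).1) * g (σ ^ 3 * mollDensity r (γ t) (γ t i).1) *
          evenMark k k (ε⁻¹ • (Torus.geometry (Fin 3)).sepVec (γ t i).1 (γ t j).1,
            (reflectVel ((Torus.geometry (Fin 3)).sepVec (γ t i).1 (γ t j).1) ((γ t i).2, (γ t j).2)).1,
            (reflectVel ((Torus.geometry (Fin 3)).sepVec (γ t i).1 (γ t j).1) ((γ t i).2, (γ t j).2)).2) := by
    intro i j hij hc
    rw [← Finset.mul_sum, sum_evenMark_diag (hunit hc), hg i, mul_one, norm_vel_sub_leftLim_eq hε h hij hc]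
    exact le_mul_of_one_le_left (le_max_right _ _) (hχ _)
  rw [h.sum_collidingPairs_eq hij hc]
  simp only
  calc ‖(γ t i).2 - (leftLim γ t i).2‖ + ‖(γ t j).2 - (leftLim γ t j).2‖
      ≤ _ + _ := add_le_add (hone hij hc) (hone hij.symm hcji)
    _ = _ := by
        rw [← Finset.sum_add_distrib]
        refine Finset.sum_congr rfl fun k _ => ?_
        rw [sum_ite_contact_eq h hij hc]

/-! ### The window statistic against the collision sums -/

/-- **The windowed speed-jump statistic is dominated by the `EvenStressEnskog` collision sums.** Along the
good orbit of `z` under a hard-sphere flow of `N + 1` spheres of reduced diameter `σ > 0` on `𝕋³`, for a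
window `(t₁, t₂]`, `0 ≤ t₁`, `t₂ ≤ τ`, a weight `χ ≥ 0` on `[0, τ] × 𝕋³` with `χ ≥ 1` on `(t₁, t₂] × 𝕋³`, and a cutoff
`g ≥ 0` equal to `1` at the mollified densities of all particles at all collision times of the window:
`ε_N (N+1)⁻¹ 𝒮_z(t₁, t₂] ≤ Σ_k collisionSum σ N Φ τ χ g Ξ_P^{kk} r z`. [folklore] -/
theorem speedJump_window_le_sum_collisionSum {σ : ℝ} (hσ : 0 < σ) {N : ℕ}
    (Φ : HardSphereFlow (Torus.geometry (Fin 3)) (hsDiameter σ N) (N + 1))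
    {z : Config (N + 1) (Fin 3) T3} (hz : z ∈ Φ.good) {t₁ t₂ τ : ℝ} (h0 : 0 ≤ t₁) (h2τ : t₂ ≤ τ) {χ : ℝ × UnitAddTorus (Fin 3) → ℝ} (hχ0 : ∀ s ∈ Icc 0 τ, ∀ x, 0 ≤ χ (s, x))
    (hχ1 : ∀ s ∈ Ioc t₁ t₂, ∀ x, 1 ≤ χ (s, x)) {g : ℝ → ℝ} (hg0 : ∀ a, 0 ≤ g a) {r : ℝ}
    (hg1 : ∀ s ∈ Ioc t₁ t₂, s ∈ collisionTimes (Torus.geometry (Fin 3)) (hsDiameter σ N)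
      (fun s => Φ.flow s z) → ∀ i, g (σ ^ 3 * mollDensity r (Φ.flow s z) (Φ.flow s z i).1) = 1) :
    hsDiameter σ N * ((N : ℝ) + 1)⁻¹ *
        collisionalTransferFunctional (Torus.geometry (Fin 3)) (hsDiameter σ N)
          (fun i _ pre post => ‖(post i).2 - (pre i).2‖) (fun s => Φ.flow s z) t₁ t₂ ≤
      ∑ k : Fin 3, collisionSum σ N Φ τ χ g (evenMark k k) r z := by
  have hε : 0 < hsDiameter σ N := hsDiameter_pos hσ N
  have htraj : IsHardSphereTrajectory (Torus.geometry (Fin 3)) (hsDiameter σ N) (N + 1)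
      (fun s => Φ.flow s z) := Φ.isTrajectory z hz
  -- the marks of the `k`-th collision sum at time `s`
  let A : Fin 3 → ℝ → ℝ := fun k s => ∑ i, ∑ j,
    (if i ≠ j ∧ ‖(Torus.geometry (Fin 3)).sepVec (Φ.flow s z i).1 (Φ.flow s z j).1‖ = hsDiameter σ N then
      χ (s, (Φ.flow s z i).1) * g (σ ^ 3 * mollDensity r (Φ.flow s z) (Φ.flow s z i).1) *
        evenMark k k ((hsDiameter σ N)⁻¹ • (Torus.geometry (Fin 3)).sepVec (Φ.flow s z i).1 (Φ.flow s z j).1,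
          (reflectVel ((Torus.geometry (Fin 3)).sepVec (Φ.flow s z i).1 (Φ.flow s z j).1)
            ((Φ.flow s z i).2, (Φ.flow s z j).2)).1,
          (reflectVel ((Torus.geometry (Fin 3)).sepVec (Φ.flow s z i).1 (Φ.flow s z j).1)
            ((Φ.flow s z i).2, (Φ.flow s z j).2)).2)
    else 0)
  have hem : ∀ (k : Fin 3) (q : V3 × V3 × V3), 0 ≤ evenMark k k q := fun k q =>
    mul_nonneg (le_max_right _ _) (mul_self_nonneg _)
  have hA0 : ∀ k, ∀ s ∈ Icc 0 τ, 0 ≤ A k s := by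
    intro k s hs
    refine Finset.sum_nonneg fun i _ => Finset.sum_nonneg fun j _ => ?_
    split_ifs
    · exact mul_nonneg (mul_nonneg (hχ0 s hs _) (hg0 _)) (hem k _)
    · exact le_rfl
  -- the right-hand side as a finite sum over the collision times of `[0, τ]`
  have hfinτ : (collisionTimes (Torus.geometry (Fin 3)) (hsDiameter σ N) (fun s => Φ.flow s z) ∩
      Icc 0 τ).Finite := htraj.locFinite 0 τ
  have hk : ∀ k, collisionSum σ N Φ τ χ g (evenMark k k) r z =
      hsDiameter σ N / ((N : ℝ) + 1) * ∑ s ∈ hfinτ.toFinset, A k s := by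
    intro k
    simp only [collisionSum]
    rw [finsum_mem_eq_finite_toFinset_sum _ hfinτ]
  have hRHS : ∑ k : Fin 3, collisionSum σ N Φ τ χ g (evenMark k k) r z =
      hsDiameter σ N / ((N : ℝ) + 1) * ∑ s ∈ hfinτ.toFinset, ∑ k : Fin 3, A k s := by
    simp only [hk]
    rw [← Finset.mul_sum, Finset.sum_comm]
  -- the left-hand side as a finite sum over the collision times of `(t₁, t₂]`
  have hfin12 := htraj.finite_collisionTimes_inter_Ioc t₁ t₂
  rw [hRHS, collisionalTransferFunctional_eq_sum _ hfin12, div_eq_mul_inv]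
  refine mul_le_mul_of_nonneg_left ?_ (by positivity)
  calc ∑ s ∈ hfin12.toFinset, ∑ p ∈ collidingPairs (Torus.geometry (Fin 3)) (hsDiameter σ N) (Φ.flow s z),
          ‖(Φ.flow s z p.1).2 - (leftLim (fun s => Φ.flow s z) s p.1).2‖
      ≤ ∑ s ∈ hfin12.toFinset, ∑ k : Fin 3, A k s := by
        refine Finset.sum_le_sum fun s hs => ?_
        obtain ⟨hsC, hsI⟩ := hfin12.mem_toFinset.1 hs
        exact sum_collidingPairs_speedJump_le hε htraj hsC (hχ1 s hsI) (hg1 s hsI hsC)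
    _ ≤ ∑ s ∈ hfinτ.toFinset, ∑ k : Fin 3, A k s := by
        refine Finset.sum_le_sum_of_subset_of_nonneg (fun s hs => ?_) fun s hs _ => ?_
        · obtain ⟨hsC, hsI⟩ := hfin12.mem_toFinset.1 hs
          exact hfinτ.mem_toFinset.2 ⟨hsC, ⟨h0.trans hsI.1.le, hsI.2.trans h2τ⟩⟩
        · exact Finset.sum_nonneg fun k _ => hA0 k s (hfinτ.mem_toFinset.1 hs).2

/-! ### The Enskog side: the pair functional of the even marks against density and energy -/

/-- The sphere-integrated even diagonal mark is at most `|S²| ‖w − v‖²` (`Ξ_P^{kk} ≤ ‖w − v‖` at a unit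
normal, the kernel is `≤ ‖w − v‖`). [folklore] -/
theorem sphereMark_evenMark_diag_le (k : Fin 3) (v w : V3) :
    sphereMark (evenMark k k) v w ≤
      (sphereMeasure : Measure (Metric.sphere (0 : V3) 1)).real univ * ‖w - v‖ ^ 2 := by
  haveI := isFiniteMeasure_sphereMeasure_V3
  have hpt : ∀ ω : Metric.sphere (0 : V3) 1,
      evenMark k k ((ω : V3), v, w) * hardSphereKernel (w, v) ω ≤ ‖w - v‖ ^ 2 := by
    intro ω
    obtain ⟨hk0, hk1⟩ := hardSphereKernel_nonneg_le v w ω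
    have hω1 : ‖(ω : V3)‖ = 1 := norm_coe_unitSphere ω
    have hωk : (ω : V3) k * (ω : V3) k ≤ 1 :=
      (Finset.single_le_sum (f := fun l => (ω : V3) l * (ω : V3) l) (fun l _ => mul_self_nonneg _)
        (Finset.mem_univ k)).trans_eq (sum_mul_self_eq_one hω1)
    have hm : max ⟪w - v, (ω : V3)⟫_ℝ 0 ≤ ‖w - v‖ := by
      refine max_le ?_ (norm_nonneg _)
      calc ⟪w - v, (ω : V3)⟫_ℝ ≤ ‖w - v‖ * ‖(ω : V3)‖ := real_inner_le_norm _ _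
        _ = ‖w - v‖ := by rw [hω1, mul_one]
    have he : evenMark k k ((ω : V3), v, w) ≤ ‖w - v‖ := by
      unfold evenMark
      calc max ⟪w - v, (ω : V3)⟫_ℝ 0 * ((ω : V3) k * (ω : V3) k) ≤ ‖w - v‖ * 1 :=
            mul_le_mul hm hωk (mul_self_nonneg _) (norm_nonneg _)
        _ = ‖w - v‖ := mul_one _
    calc evenMark k k ((ω : V3), v, w) * hardSphereKernel (w, v) ω ≤ ‖w - v‖ * ‖w - v‖ :=
          mul_le_mul he hk1 hk0 (norm_nonneg _)
      _ = ‖w - v‖ ^ 2 := (sq _).symm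
  have hint : Integrable (fun ω : Metric.sphere (0 : V3) 1 =>
      evenMark k k ((ω : V3), v, w) * hardSphereKernel (w, v) ω) sphereMeasure := by
    refine integrable_sphereMeasure_of_continuous_V3 ?_
    have h1 : Continuous fun ω : Metric.sphere (0 : V3) 1 => evenMark k k ((ω : V3), v, w) :=
      (continuous_evenMark k k).comp (by fun_prop)
    have h2 : Continuous fun ω : Metric.sphere (0 : V3) 1 => hardSphereKernel (w, v) ω := by
      unfold hardSphereKernel; fun_prop
    exact h1.mul h2
  calc sphereMark (evenMark k k) v w ≤ ∫ _ω : Metric.sphere (0 : V3) 1, ‖w - v‖ ^ 2 ∂sphereMeasure :=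
        integral_mono hint (integrable_const _) hpt
    _ = _ := by rw [integral_const, smul_eq_mul]

/-- The cone kernel of `EvenCollisionTubeFunctional` is the cone kernel of `DensityCapNegative`
(definitional). [folklore] -/
theorem coneKernel_eq_cone (r : ℝ) (x y : T3) : coneKernel r x y = DensityCapNegative.cone r x y := rfl

/-- **The pair functional of the even diagonal marks against density and energy**: for one
configuration of `N + 1` particles and `r > 0`,
`B_r Ξ_P^{kk} (x₀) ≤ 4|S²| · ρ_r(x₀) · e_r(x₀)`, `e_r(x₀) = (N+1)⁻¹ Σⱼ b_r(xⱼ, x₀) ‖vⱼ‖²` the cone-mollified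
(twice) kinetic energy density (`‖vᵢ − vⱼ‖² ≤ 2‖vᵢ‖² + 2‖vⱼ‖²`). [folklore] -/
theorem pairFunctional_evenMark_diag_le {N : ℕ} (k : Fin 3) {r : ℝ} (hr : 0 < r)
    (w : Config (N + 1) (Fin 3) T3) (x₀ : T3) :
    pairFunctional r (evenMark k k) w x₀ ≤
      4 * (sphereMeasure : Measure (Metric.sphere (0 : V3) 1)).real univ * mollDensity r w x₀ *
        ((((N + 1 : ℕ) : ℝ))⁻¹ * ∑ j, coneKernel r (w j).1 x₀ * ‖(w j).2‖ ^ 2) := by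
  set CS : ℝ := (sphereMeasure : Measure (Metric.sphere (0 : V3) 1)).real univ with hCS
  have hCS0 : 0 ≤ CS := measureReal_nonneg
  set c : Fin (N + 1) → ℝ := fun i => coneKernel r (w i).1 x₀ with hc
  have hc0 : ∀ i, 0 ≤ c i := fun i => DensityCapNegative.cone_nonneg hr (w i).1 x₀
  set e : Fin (N + 1) → ℝ := fun i => ‖(w i).2‖ ^ 2 with he
  rw [pairFunctional_eq_double_sum, mollDensity_eq_avg]
  have hterm : ∀ i j, c i * c j * sphereMark (evenMark k k) (w i).2 (w j).2 ≤
      2 * CS * (c i * e i * c j + c i * (c j * e j)) := by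
    intro i j
    have h1 := sphereMark_evenMark_diag_le k (w i).2 (w j).2
    have h2 : ‖(w j).2 - (w i).2‖ ^ 2 ≤ 2 * e i + 2 * e j := by
      simp only [he]
      nlinarith [norm_sub_le (w j).2 (w i).2, norm_nonneg ((w j).2 - (w i).2), norm_nonneg (w i).2,
        norm_nonneg (w j).2, sq_nonneg (‖(w i).2‖ - ‖(w j).2‖)]
    calc c i * c j * sphereMark (evenMark k k) (w i).2 (w j).2 ≤ c i * c j * (CS * (2 * e i + 2 * e j)) :=
          mul_le_mul_of_nonneg_left (h1.trans (mul_le_mul_of_nonneg_left h2 hCS0))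
            (mul_nonneg (hc0 i) (hc0 j))
      _ = _ := by ring
  have hsum : ∑ i, ∑ j, 2 * CS * (c i * e i * c j + c i * (c j * e j)) =
      2 * CS * ((∑ i, c i * e i) * ∑ j, c j) + 2 * CS * ((∑ i, c i) * ∑ j, c j * e j) := by
    rw [Finset.sum_mul_sum, Finset.sum_mul_sum, Finset.mul_sum, Finset.mul_sum, ← Finset.sum_add_distrib]
    refine Finset.sum_congr rfl fun i _ => ?_
    rw [Finset.mul_sum, Finset.mul_sum, ← Finset.sum_add_distrib]
    refine Finset.sum_congr rfl fun j _ => ?_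
    ring
  calc (((N + 1 : ℕ) : ℝ))⁻¹ * (((N + 1 : ℕ) : ℝ))⁻¹ *
        ∑ i, ∑ j, c i * c j * sphereMark (evenMark k k) (w i).2 (w j).2
      ≤ (((N + 1 : ℕ) : ℝ))⁻¹ * (((N + 1 : ℕ) : ℝ))⁻¹ *
          ∑ i, ∑ j, 2 * CS * (c i * e i * c j + c i * (c j * e j)) :=
        mul_le_mul_of_nonneg_left (Finset.sum_le_sum fun i _ => Finset.sum_le_sum fun j _ => hterm i j)
          (by positivity)
    _ = 4 * CS * ((((N + 1 : ℕ) : ℝ))⁻¹ * ∑ i, c i) *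
          ((((N + 1 : ℕ) : ℝ))⁻¹ * ∑ j, c j * e j) := by
        rw [hsum]
        ring

/-- **Haar integral of the cone-mollified energy density**: `∫ e_r(x₀) dx₀ = (N+1)⁻¹ Σⱼ ‖vⱼ‖²`
(`= 2·E_kin/(N+1)`) for `0 < r ≤ 1/2` (the cone kernel is a probability density,
`DensityCapNegative.coneMass_eq_one`). [folklore] -/
theorem integral_coneEnergy {N : ℕ} {r : ℝ} (hr : 0 < r) (hr2 : r ≤ 1 / 2) (w : Config (N + 1) (Fin 3) T3) :
    ∫ x₀ : T3, (((N + 1 : ℕ) : ℝ))⁻¹ * ∑ j, coneKernel r (w j).1 x₀ * ‖(w j).2‖ ^ 2 =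
      (((N + 1 : ℕ) : ℝ))⁻¹ * (2 * configEnergy w) := by
  have hci : ∀ j : Fin (N + 1), Integrable (fun x₀ : T3 => coneKernel r (w j).1 x₀) volume := by
    intro j
    refine Continuous.integrable_of_hasCompactSupport ?_ (HasCompactSupport.of_compactSpace _)
    unfold coneKernel
    exact continuous_const.mul ((continuous_const.sub
      ((Torus.continuous_euclidDist.comp (continuous_const.prodMk continuous_id)).div_const r)).max
        continuous_const)
  rw [integral_const_mul, integral_finsetSum _ fun j _ => (hci j).mul_const _]
  congr 1
  rw [← sum_norm_sq_eq_two_mul_configEnergy]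
  refine Finset.sum_congr rfl fun j _ => ?_
  rw [integral_mul_const]
  simp only [coneKernel_eq_cone, DensityCapNegative.integral_cone, DensityCapNegative.coneMass_eq_one hr hr2,
    one_mul]

end Summit.AtomisticToContinuum.HydrodynamicLimit.Theorems.JParityClosureSpeedJumpWindow

end
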